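import Summits.NavierStokesRegularity.NavierStokesRegularity.Theorems.ClockStretchingLawClockCeilingUnidirectionalVorticityLiouville
import HarnessLib

/-!
# Route ClockStretchingLaw, crux `ClockCeiling` (stmt-NavierStokesRegularity-10570) — slice-wise line
# invariance kills a Type-I ancient mild field

Line `registered`, lead c7, stub `stub_sliceLineInvariantLiouville` (`--supports 10570`).

The symmetry core of the Giga–Miura Liouville theorem
(`ClockStretchingLawClockCeilingUnidirectionalVorticityLiouville.lean`), recorded without any
vorticity hypothesis: if every slice `u(t, ·)`, `t < 0`, of an element of the Type-I ancient mild
class `A_C` is invariant under all translations along SOME line `ℝ b(t)` (the line may depend on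
`t`), then `u ≡ 0`. This upgrades the fixed-direction 2.5-D leaves `stub_shearLiouville`
(crux 10570, c1) and `stub_lineLiouvilleEnd` (crux 14062) to slice-dependent directions.

* `sliceLineInvariantLiouville` — all slices; `sliceLineInvariantLiouville_end` — a backward end
  `t < T ≤ 0` suffices; `stub_sliceLineInvariantLiouville` — registered form.

Proof: the subspaces `W(t) = {b | u(t, · + h b) = u(t, ·) ∀ h}` are nested forward in time
(`stub_translationInvariantAfter`, uniqueness of bounded Oseen-mild solutions), stabilise on a
far-past end (`exists_end_submodule_const`), so one fixed nonzero `b` works for all `t < t₁`;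
`stub_lineLiouvilleEnd` (rotation covariance + KNSS 2009 Thm 5.1 / Remark 6.1) and forward uniqueness
(`vanishes_of_vanishes_before`) conclude.

## References

* G. Koch, N. Nadirashvili, G. Seregin, V. Šverák, Acta Math. 203 (2009) 83–105, Thm 5.1,
  Remark 6.1, §1 p. 3 (symmetries) (arXiv:0709.3599). [KochNadirashviliSereginSverak2009]
* Y. Giga, H. Miura, Commun. Math. Phys. 303 (2011) 289–300, proof of Thm 1.1. [GigaMiura2011]
-/

noncomputable section

-- the summit and its single sub-problem share the name (CONVENTIONS §1), as in every Theorems file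
set_option linter.dupNamespace false

open Set Function Filter Topology Metric Module

namespace Summit.NavierStokesRegularity.NavierStokesRegularity.Theorems

open Literature.Analysis Literature.Analysis.FluidPDE
open Summit.NavierStokesRegularity.NavierStokesRegularity.Theorems.SymmetryModuliCountSymmetricLiouville

/-- **A Type-I ancient mild field each of whose slices is invariant along SOME line vanishes.** If
for every `t < 0` there is `b(t) ≠ 0` with `u(t, x + h b(t)) = u(t, x)` for all `x, h`, then
`u ≡ 0` on `t < 0`: the subspaces of invariance lines are nested forward in time
(`stub_translationInvariantAfter`), stabilise on a far-past end (`exists_end_submodule_const`), and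
the fixed-line leaf `stub_lineLiouvilleEnd` plus forward uniqueness conclude. [cite: KochNadirashviliSereginSverak2009, Thm 5.1 and Remark 6.1 (arXiv:0709.3599 pp. 9, 11)] -/
theorem sliceLineInvariantLiouville {C : ℝ}
    {u : ℝ → EuclideanSpace ℝ (Fin 3) → EuclideanSpace ℝ (Fin 3)} (hu : IsTypeIAncientMild C u)
    (hline : ∀ t < 0, ∃ b : EuclideanSpace ℝ (Fin 3), b ≠ 0 ∧
      ∀ (h : ℝ) (x : EuclideanSpace ℝ (Fin 3)), u t (x + h • b) = u t x) :
    ∀ t < 0, ∀ x, u t x = 0 := by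
  let W : ℝ → Submodule ℝ (EuclideanSpace ℝ (Fin 3)) := fun t =>
    { carrier := {b | ∀ (h : ℝ) (x : EuclideanSpace ℝ (Fin 3)), u t (x + h • b) = u t x}
      add_mem' := fun {a b} ha hb h x => by
        rw [smul_add, ← add_assoc, hb h (x + h • a), ha h x]
      zero_mem' := fun h x => by rw [smul_zero, add_zero]
      smul_mem' := fun c b hb h x => by rw [smul_smul]; exact hb (h * c) x }
  have hmemW : ∀ (t : ℝ) (b : EuclideanSpace ℝ (Fin 3)),
      b ∈ W t ↔ ∀ (h : ℝ) (x : EuclideanSpace ℝ (Fin 3)), u t (x + h • b) = u t x :=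
    fun _ _ => Iff.rfl
  have hmono : ∀ s t : ℝ, s < t → t < 0 → W s ≤ W t := by
    intro s t hst ht b hb
    rw [hmemW] at hb ⊢
    intro h x
    exact stub_translationInvariantAfter C u hu s (h • b) (hst.trans ht) (fun y => hb h y) t hst ht x
  obtain ⟨t₁, ht₁, hconst⟩ := exists_end_submodule_const W hmono
  obtain ⟨b, hb, hbW⟩ := hline t₁ ht₁
  have hbW₁ : b ∈ W t₁ := (hmemW t₁ b).2 hbW
  have hinv : ∀ t < t₁, ∀ (x : EuclideanSpace ℝ (Fin 3)) (s : ℝ), u t (x + s • b) = u t x := by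
    intro t ht x s
    have hmem : b ∈ W t := by rw [hconst t ht]; exact hbW₁
    exact (hmemW t b).1 hmem s x
  exact vanishes_of_vanishes_before hu ht₁ (stub_lineLiouvilleEnd C u hu b t₁ hb ht₁.le hinv)

/-- **End version**: line invariance of the slices of a backward end `t < T ≤ 0` suffices (time
shift into the past, `IsTypeIAncientMild.comp_sub_right`, then forward uniqueness). [cite: KochNadirashviliSereginSverak2009, §1 p. 3 (symmetries), Thm 5.1, Remark 6.1] -/
theorem sliceLineInvariantLiouville_end {C T : ℝ}
    {u : ℝ → EuclideanSpace ℝ (Fin 3) → EuclideanSpace ℝ (Fin 3)} (hu : IsTypeIAncientMild C u)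
    (hT : T ≤ 0)
    (hline : ∀ t < T, ∃ b : EuclideanSpace ℝ (Fin 3), b ≠ 0 ∧
      ∀ (h : ℝ) (x : EuclideanSpace ℝ (Fin 3)), u t (x + h • b) = u t x) :
    ∀ t < 0, ∀ x, u t x = 0 := by
  have hv : IsTypeIAncientMild C (fun t => u (t - (-T))) := hu.comp_sub_right (neg_nonneg.2 hT)
  have hv0 : ∀ t < 0, ∀ x, (fun t => u (t - (-T))) t x = 0 :=
    sliceLineInvariantLiouville hv fun t ht => hline (t - (-T)) (by linarith)
  have hbefore : ∀ t < T - 1, ∀ x, u t x = 0 := by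
    intro t ht x
    have key := hv0 (t + (-T)) (by linarith) x
    simp only [add_sub_cancel_right] at key
    exact key
  exact vanishes_of_vanishes_before hu (by linarith) hbefore

/-- **Stub `stub_sliceLineInvariantLiouville` (crux stmt-NavierStokesRegularity-10570, line
`registered`)**: registered form of `sliceLineInvariantLiouville`. [cite: KochNadirashviliSereginSverak2009, Thm 5.1 and Remark 6.1 (arXiv:0709.3599 pp. 9, 11)] -/
theorem stub_sliceLineInvariantLiouville :
    ∀ (C : ℝ) (u : ℝ → EuclideanSpace ℝ (Fin 3) → EuclideanSpace ℝ (Fin 3)), Literature.Analysis.FluidPDE.IsTypeIAncientMild C u → (∀ t < 0, ∃ b : EuclideanSpace ℝ (Fin 3), b ≠ 0 ∧ ∀ (h : ℝ) (x : EuclideanSpace ℝ (Fin 3)), u t (x + h • b) = u t x) → ∀ t < 0, ∀ x, u t x = 0 :=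
  fun _ _ hu hline => sliceLineInvariantLiouville hu hline

end Summit.NavierStokesRegularity.NavierStokesRegularity.Theorems

end
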